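import Mathlib.Analysis.InnerProductSpace.PiL2
import HarnessLib

/-!
# The LOCAL twin (hcp) cage, core cells: a twin-dozen member is caged by its four dozen neighbours
# (crux `CoaxialWallLaw`, stmt-Ventures-19481, line `WallLedgerF`; census-free brick for the OFF-MODULE tail)

HONEST FRAMING. Venture `Summits/Ventures/Crystal3D` (cell `crystal3d-full`), helper `--supports` the crux
`CoaxialWallLaw` (stmt-Ventures-19481, `route-Ventures-StickyWulffConstant`), REGISTERED line `WallLedgerF` (planner
cf-p1, (lvi)/(lxii) bricks for the off-module tail).  Rung credit; F-C1 not moved; census-free.  Companion of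
`…TwinCageCore` (eleven members cage the twelfth) and `…KissingCageLocal` (fcc: four neighbours cage a slot): here the
TWIN DOZEN in signed cubic coordinates (normal `(1,1,1)/√3`, table scaled by `3`: nine slots `3s`, `s·(1,1,1) ≤ 0`, and
three mirrors `3s + 4·(1,1,1)`), and the statement that `Σ xᵢ² = 2`, `x·τ₀ ≥ 3` (the cap of the member `τ₀/3`) and
`x·τ ≤ 3` for the FOUR table entries `τ` with `τ₀·τ = 9` (its dozen neighbours at `60°`) force `3x = τ₀`.
* `twin_local_inplane` (vertex type `3.3.4.4`), `twin_local_lower`, `twin_local_mirror` (type `3.4.3.4`) — `nlinarith` cells;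
* `twin_local_case_0 … _11`, `twin_local_core_triple` — the twelve targets by coordinate permutation.
The geometric statement (any frame, any menu normal) follows in `…TwinCageLocal`.
WHAT THIS IS NOT: not the tail; F-C1 not moved.
-/

noncomputable section

namespace Summit.Ventures.Crystal3D.Theorems

/-! ### The three canonical cells -/

/-- In-plane member `(1,−1,0)`: neighbours `(1,0,−1)`, `(0,−1,1)` (in-plane), `(0,−1,−1)` (below), `(4,1,1)/3` (mirror). -/
theorem twin_local_inplane (u w z : ℝ) (hn : u ^ 2 + w ^ 2 + z ^ 2 = 2) (hcap : 1 ≤ u - w)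
    (h1 : u - z ≤ 1) (h2 : -w + z ≤ 1) (h3 : -w - z ≤ 1) (m1 : 4 * u + w + z ≤ 3) :
    u = 1 ∧ w = -1 ∧ z = 0 := by
  have hz : z = 0 := by
    nlinarith [mul_nonneg (sub_nonneg.2 h1) (sub_nonneg.2 h2), mul_nonneg (sub_nonneg.2 h1) (sub_nonneg.2 h3),
      mul_nonneg (sub_nonneg.2 h2) (sub_nonneg.2 m1), mul_nonneg (sub_nonneg.2 h3) (sub_nonneg.2 m1),
      mul_nonneg (sub_nonneg.2 hcap) (sub_nonneg.2 h1), mul_nonneg (sub_nonneg.2 hcap) (sub_nonneg.2 m1),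
      mul_nonneg (sub_nonneg.2 hcap) (sub_nonneg.2 h2), mul_nonneg (sub_nonneg.2 hcap) (sub_nonneg.2 h3),
      mul_nonneg (sub_nonneg.2 h2) (sub_nonneg.2 h3), sq_nonneg z, sq_nonneg (u + w), sq_nonneg (u - 1), sq_nonneg (w + 1)]
  subst hz
  have hu : u = 1 := by nlinarith
  subst hu
  have hw : w = -1 := by nlinarith
  exact ⟨rfl, hw, rfl⟩

/-- Lower member `(−1,−1,0)`: neighbours `(−1,0,∓1)`, `(0,−1,∓1)`. -/
theorem twin_local_lower (u w z : ℝ) (hn : u ^ 2 + w ^ 2 + z ^ 2 = 2) (hcap : 1 ≤ -u - w)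
    (h1 : -u - z ≤ 1) (h2 : -w - z ≤ 1) (h3 : -u + z ≤ 1) (h4 : -w + z ≤ 1) :
    u = -1 ∧ w = -1 ∧ z = 0 := by
  have hz : z = 0 := by
    nlinarith [mul_nonneg (sub_nonneg.2 h1) (sub_nonneg.2 h4), mul_nonneg (sub_nonneg.2 h2) (sub_nonneg.2 h3),
      mul_nonneg (sub_nonneg.2 h1) (sub_nonneg.2 h2), mul_nonneg (sub_nonneg.2 h3) (sub_nonneg.2 h4), sq_nonneg z,
      sq_nonneg (u - w)]
  subst hz
  have hu : u = -1 := by nlinarith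
  subst hu
  have hw : w = -1 := by nlinarith
  exact ⟨rfl, hw, rfl⟩

/-- Mirror member `(1,1,4)/3`: neighbours `(0,−1,1)`, `(−1,0,1)` (in-plane), `(1,4,1)/3`, `(4,1,1)/3` (mirrors). -/
theorem twin_local_mirror (u w z : ℝ) (hn : u ^ 2 + w ^ 2 + z ^ 2 = 2) (hcap : 3 ≤ u + w + 4 * z)
    (h1 : -w + z ≤ 1) (h2 : -u + z ≤ 1) (m2 : u + 4 * w + z ≤ 3) (m3 : 4 * u + w + z ≤ 3) :
    3 * u = 1 ∧ 3 * w = 1 ∧ 3 * z = 4 := by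
  have hz : 3 * z = 4 := by
    nlinarith [mul_nonneg (sub_nonneg.2 h1) (sub_nonneg.2 h2), mul_nonneg (sub_nonneg.2 h1) (sub_nonneg.2 m3),
      mul_nonneg (sub_nonneg.2 h2) (sub_nonneg.2 m2), mul_nonneg (sub_nonneg.2 m2) (sub_nonneg.2 m3),
      mul_nonneg (sub_nonneg.2 hcap) (sub_nonneg.2 h1), mul_nonneg (sub_nonneg.2 hcap) (sub_nonneg.2 h2),
      mul_nonneg (sub_nonneg.2 hcap) (sub_nonneg.2 m2), mul_nonneg (sub_nonneg.2 hcap) (sub_nonneg.2 m3),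
      mul_nonneg (sub_nonneg.2 h1) (sub_nonneg.2 m2), mul_nonneg (sub_nonneg.2 h2) (sub_nonneg.2 m3),
      sq_nonneg (u - w), sq_nonneg (3 * z - 4), sq_nonneg (3 * u - 1), sq_nonneg (3 * w - 1)]
  have hu : 3 * u = 1 := by nlinarith
  have hw : 3 * w = 1 := by nlinarith
  exact ⟨hu, hw, hz⟩

/-! ### The twelve targets -/

/-- Local twin cage, target `(3, -3, 0)` (inplane cell). -/
theorem twin_local_case_0 (x : Fin 3 → ℝ) (hn : x 0 ^ 2 + x 1 ^ 2 + x 2 ^ 2 = 2)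
    (hcap : 3 ≤ x 0 * ((3 : ℤ) : ℝ) + x 1 * ((-3 : ℤ) : ℝ) + x 2 * ((0 : ℤ) : ℝ))
    (h : ∀ τ ∈ ({(3, -3, 0), (-3, 3, 0), (-3, -3, 0), (3, 0, -3), (-3, 0, 3), (-3, 0, -3), (0, 3, -3), (0, -3, 3), (0, -3, -3), (1, 1, 4), (1, 4, 1), (4, 1, 1)} : Finset (ℤ × ℤ × ℤ)), (3 : ℤ) * τ.1 + (-3 : ℤ) * τ.2.1 + (0 : ℤ) * τ.2.2 = 9 →
      x 0 * τ.1 + x 1 * τ.2.1 + x 2 * τ.2.2 ≤ 3) :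
    3 * x 0 = ((3 : ℤ) : ℝ) ∧ 3 * x 1 = ((-3 : ℤ) : ℝ) ∧ 3 * x 2 = ((0 : ℤ) : ℝ) := by
  have g0 := h (3, 0, -3) (by decide) (by norm_num)
  have g1 := h (0, -3, 3) (by decide) (by norm_num)
  have g2 := h (0, -3, -3) (by decide) (by norm_num)
  have g3 := h (4, 1, 1) (by decide) (by norm_num)
  norm_num at g0 g1 g2 g3 hcap
  obtain ⟨e1, e2, e3⟩ := twin_local_inplane (x 0) (x 1) (x 2) (by nlinarith [hn]) (by linarith [hcap]) (by linarith [g0]) (by linarith [g1]) (by linarith [g2]) (by linarith [g3])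
  push_cast
  exact ⟨by linarith, by linarith, by linarith⟩

/-- Local twin cage, target `(-3, 3, 0)` (inplane cell). -/
theorem twin_local_case_1 (x : Fin 3 → ℝ) (hn : x 0 ^ 2 + x 1 ^ 2 + x 2 ^ 2 = 2)
    (hcap : 3 ≤ x 0 * ((-3 : ℤ) : ℝ) + x 1 * ((3 : ℤ) : ℝ) + x 2 * ((0 : ℤ) : ℝ))
    (h : ∀ τ ∈ ({(3, -3, 0), (-3, 3, 0), (-3, -3, 0), (3, 0, -3), (-3, 0, 3), (-3, 0, -3), (0, 3, -3), (0, -3, 3), (0, -3, -3), (1, 1, 4), (1, 4, 1), (4, 1, 1)} : Finset (ℤ × ℤ × ℤ)), (-3 : ℤ) * τ.1 + (3 : ℤ) * τ.2.1 + (0 : ℤ) * τ.2.2 = 9 →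
      x 0 * τ.1 + x 1 * τ.2.1 + x 2 * τ.2.2 ≤ 3) :
    3 * x 0 = ((-3 : ℤ) : ℝ) ∧ 3 * x 1 = ((3 : ℤ) : ℝ) ∧ 3 * x 2 = ((0 : ℤ) : ℝ) := by
  have g0 := h (0, 3, -3) (by decide) (by norm_num)
  have g1 := h (-3, 0, 3) (by decide) (by norm_num)
  have g2 := h (-3, 0, -3) (by decide) (by norm_num)
  have g3 := h (1, 4, 1) (by decide) (by norm_num)
  norm_num at g0 g1 g2 g3 hcap
  obtain ⟨e1, e2, e3⟩ := twin_local_inplane (x 1) (x 0) (x 2) (by nlinarith [hn]) (by linarith [hcap]) (by linarith [g0]) (by linarith [g1]) (by linarith [g2]) (by linarith [g3])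
  push_cast
  exact ⟨by linarith, by linarith, by linarith⟩

/-- Local twin cage, target `(-3, -3, 0)` (lower cell). -/
theorem twin_local_case_2 (x : Fin 3 → ℝ) (hn : x 0 ^ 2 + x 1 ^ 2 + x 2 ^ 2 = 2)
    (hcap : 3 ≤ x 0 * ((-3 : ℤ) : ℝ) + x 1 * ((-3 : ℤ) : ℝ) + x 2 * ((0 : ℤ) : ℝ))
    (h : ∀ τ ∈ ({(3, -3, 0), (-3, 3, 0), (-3, -3, 0), (3, 0, -3), (-3, 0, 3), (-3, 0, -3), (0, 3, -3), (0, -3, 3), (0, -3, -3), (1, 1, 4), (1, 4, 1), (4, 1, 1)} : Finset (ℤ × ℤ × ℤ)), (-3 : ℤ) * τ.1 + (-3 : ℤ) * τ.2.1 + (0 : ℤ) * τ.2.2 = 9 →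
      x 0 * τ.1 + x 1 * τ.2.1 + x 2 * τ.2.2 ≤ 3) :
    3 * x 0 = ((-3 : ℤ) : ℝ) ∧ 3 * x 1 = ((-3 : ℤ) : ℝ) ∧ 3 * x 2 = ((0 : ℤ) : ℝ) := by
  have g0 := h (-3, 0, -3) (by decide) (by norm_num)
  have g1 := h (0, -3, -3) (by decide) (by norm_num)
  have g2 := h (-3, 0, 3) (by decide) (by norm_num)
  have g3 := h (0, -3, 3) (by decide) (by norm_num)
  norm_num at g0 g1 g2 g3 hcap
  obtain ⟨e1, e2, e3⟩ := twin_local_lower (x 0) (x 1) (x 2) (by nlinarith [hn]) (by linarith [hcap]) (by linarith [g0]) (by linarith [g1]) (by linarith [g2]) (by linarith [g3])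
  push_cast
  exact ⟨by linarith, by linarith, by linarith⟩

/-- Local twin cage, target `(3, 0, -3)` (inplane cell). -/
theorem twin_local_case_3 (x : Fin 3 → ℝ) (hn : x 0 ^ 2 + x 1 ^ 2 + x 2 ^ 2 = 2)
    (hcap : 3 ≤ x 0 * ((3 : ℤ) : ℝ) + x 1 * ((0 : ℤ) : ℝ) + x 2 * ((-3 : ℤ) : ℝ))
    (h : ∀ τ ∈ ({(3, -3, 0), (-3, 3, 0), (-3, -3, 0), (3, 0, -3), (-3, 0, 3), (-3, 0, -3), (0, 3, -3), (0, -3, 3), (0, -3, -3), (1, 1, 4), (1, 4, 1), (4, 1, 1)} : Finset (ℤ × ℤ × ℤ)), (3 : ℤ) * τ.1 + (0 : ℤ) * τ.2.1 + (-3 : ℤ) * τ.2.2 = 9 →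
      x 0 * τ.1 + x 1 * τ.2.1 + x 2 * τ.2.2 ≤ 3) :
    3 * x 0 = ((3 : ℤ) : ℝ) ∧ 3 * x 1 = ((0 : ℤ) : ℝ) ∧ 3 * x 2 = ((-3 : ℤ) : ℝ) := by
  have g0 := h (3, -3, 0) (by decide) (by norm_num)
  have g1 := h (0, 3, -3) (by decide) (by norm_num)
  have g2 := h (0, -3, -3) (by decide) (by norm_num)
  have g3 := h (4, 1, 1) (by decide) (by norm_num)
  norm_num at g0 g1 g2 g3 hcap
  obtain ⟨e1, e2, e3⟩ := twin_local_inplane (x 0) (x 2) (x 1) (by nlinarith [hn]) (by linarith [hcap]) (by linarith [g0]) (by linarith [g1]) (by linarith [g2]) (by linarith [g3])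
  push_cast
  exact ⟨by linarith, by linarith, by linarith⟩

/-- Local twin cage, target `(-3, 0, 3)` (inplane cell). -/
theorem twin_local_case_4 (x : Fin 3 → ℝ) (hn : x 0 ^ 2 + x 1 ^ 2 + x 2 ^ 2 = 2)
    (hcap : 3 ≤ x 0 * ((-3 : ℤ) : ℝ) + x 1 * ((0 : ℤ) : ℝ) + x 2 * ((3 : ℤ) : ℝ))
    (h : ∀ τ ∈ ({(3, -3, 0), (-3, 3, 0), (-3, -3, 0), (3, 0, -3), (-3, 0, 3), (-3, 0, -3), (0, 3, -3), (0, -3, 3), (0, -3, -3), (1, 1, 4), (1, 4, 1), (4, 1, 1)} : Finset (ℤ × ℤ × ℤ)), (-3 : ℤ) * τ.1 + (0 : ℤ) * τ.2.1 + (3 : ℤ) * τ.2.2 = 9 →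
      x 0 * τ.1 + x 1 * τ.2.1 + x 2 * τ.2.2 ≤ 3) :
    3 * x 0 = ((-3 : ℤ) : ℝ) ∧ 3 * x 1 = ((0 : ℤ) : ℝ) ∧ 3 * x 2 = ((3 : ℤ) : ℝ) := by
  have g0 := h (0, -3, 3) (by decide) (by norm_num)
  have g1 := h (-3, 3, 0) (by decide) (by norm_num)
  have g2 := h (-3, -3, 0) (by decide) (by norm_num)
  have g3 := h (1, 1, 4) (by decide) (by norm_num)
  norm_num at g0 g1 g2 g3 hcap
  obtain ⟨e1, e2, e3⟩ := twin_local_inplane (x 2) (x 0) (x 1) (by nlinarith [hn]) (by linarith [hcap]) (by linarith [g0]) (by linarith [g1]) (by linarith [g2]) (by linarith [g3])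
  push_cast
  exact ⟨by linarith, by linarith, by linarith⟩

/-- Local twin cage, target `(-3, 0, -3)` (lower cell). -/
theorem twin_local_case_5 (x : Fin 3 → ℝ) (hn : x 0 ^ 2 + x 1 ^ 2 + x 2 ^ 2 = 2)
    (hcap : 3 ≤ x 0 * ((-3 : ℤ) : ℝ) + x 1 * ((0 : ℤ) : ℝ) + x 2 * ((-3 : ℤ) : ℝ))
    (h : ∀ τ ∈ ({(3, -3, 0), (-3, 3, 0), (-3, -3, 0), (3, 0, -3), (-3, 0, 3), (-3, 0, -3), (0, 3, -3), (0, -3, 3), (0, -3, -3), (1, 1, 4), (1, 4, 1), (4, 1, 1)} : Finset (ℤ × ℤ × ℤ)), (-3 : ℤ) * τ.1 + (0 : ℤ) * τ.2.1 + (-3 : ℤ) * τ.2.2 = 9 →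
      x 0 * τ.1 + x 1 * τ.2.1 + x 2 * τ.2.2 ≤ 3) :
    3 * x 0 = ((-3 : ℤ) : ℝ) ∧ 3 * x 1 = ((0 : ℤ) : ℝ) ∧ 3 * x 2 = ((-3 : ℤ) : ℝ) := by
  have g0 := h (-3, -3, 0) (by decide) (by norm_num)
  have g1 := h (0, -3, -3) (by decide) (by norm_num)
  have g2 := h (-3, 3, 0) (by decide) (by norm_num)
  have g3 := h (0, 3, -3) (by decide) (by norm_num)
  norm_num at g0 g1 g2 g3 hcap
  obtain ⟨e1, e2, e3⟩ := twin_local_lower (x 0) (x 2) (x 1) (by nlinarith [hn]) (by linarith [hcap]) (by linarith [g0]) (by linarith [g1]) (by linarith [g2]) (by linarith [g3])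
  push_cast
  exact ⟨by linarith, by linarith, by linarith⟩

/-- Local twin cage, target `(0, 3, -3)` (inplane cell). -/
theorem twin_local_case_6 (x : Fin 3 → ℝ) (hn : x 0 ^ 2 + x 1 ^ 2 + x 2 ^ 2 = 2)
    (hcap : 3 ≤ x 0 * ((0 : ℤ) : ℝ) + x 1 * ((3 : ℤ) : ℝ) + x 2 * ((-3 : ℤ) : ℝ))
    (h : ∀ τ ∈ ({(3, -3, 0), (-3, 3, 0), (-3, -3, 0), (3, 0, -3), (-3, 0, 3), (-3, 0, -3), (0, 3, -3), (0, -3, 3), (0, -3, -3), (1, 1, 4), (1, 4, 1), (4, 1, 1)} : Finset (ℤ × ℤ × ℤ)), (0 : ℤ) * τ.1 + (3 : ℤ) * τ.2.1 + (-3 : ℤ) * τ.2.2 = 9 →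
      x 0 * τ.1 + x 1 * τ.2.1 + x 2 * τ.2.2 ≤ 3) :
    3 * x 0 = ((0 : ℤ) : ℝ) ∧ 3 * x 1 = ((3 : ℤ) : ℝ) ∧ 3 * x 2 = ((-3 : ℤ) : ℝ) := by
  have g0 := h (-3, 3, 0) (by decide) (by norm_num)
  have g1 := h (3, 0, -3) (by decide) (by norm_num)
  have g2 := h (-3, 0, -3) (by decide) (by norm_num)
  have g3 := h (1, 4, 1) (by decide) (by norm_num)
  norm_num at g0 g1 g2 g3 hcap
  obtain ⟨e1, e2, e3⟩ := twin_local_inplane (x 1) (x 2) (x 0) (by nlinarith [hn]) (by linarith [hcap]) (by linarith [g0]) (by linarith [g1]) (by linarith [g2]) (by linarith [g3])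
  push_cast
  exact ⟨by linarith, by linarith, by linarith⟩

/-- Local twin cage, target `(0, -3, 3)` (inplane cell). -/
theorem twin_local_case_7 (x : Fin 3 → ℝ) (hn : x 0 ^ 2 + x 1 ^ 2 + x 2 ^ 2 = 2)
    (hcap : 3 ≤ x 0 * ((0 : ℤ) : ℝ) + x 1 * ((-3 : ℤ) : ℝ) + x 2 * ((3 : ℤ) : ℝ))
    (h : ∀ τ ∈ ({(3, -3, 0), (-3, 3, 0), (-3, -3, 0), (3, 0, -3), (-3, 0, 3), (-3, 0, -3), (0, 3, -3), (0, -3, 3), (0, -3, -3), (1, 1, 4), (1, 4, 1), (4, 1, 1)} : Finset (ℤ × ℤ × ℤ)), (0 : ℤ) * τ.1 + (-3 : ℤ) * τ.2.1 + (3 : ℤ) * τ.2.2 = 9 →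
      x 0 * τ.1 + x 1 * τ.2.1 + x 2 * τ.2.2 ≤ 3) :
    3 * x 0 = ((0 : ℤ) : ℝ) ∧ 3 * x 1 = ((-3 : ℤ) : ℝ) ∧ 3 * x 2 = ((3 : ℤ) : ℝ) := by
  have g0 := h (-3, 0, 3) (by decide) (by norm_num)
  have g1 := h (3, -3, 0) (by decide) (by norm_num)
  have g2 := h (-3, -3, 0) (by decide) (by norm_num)
  have g3 := h (1, 1, 4) (by decide) (by norm_num)
  norm_num at g0 g1 g2 g3 hcap
  obtain ⟨e1, e2, e3⟩ := twin_local_inplane (x 2) (x 1) (x 0) (by nlinarith [hn]) (by linarith [hcap]) (by linarith [g0]) (by linarith [g1]) (by linarith [g2]) (by linarith [g3])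
  push_cast
  exact ⟨by linarith, by linarith, by linarith⟩

/-- Local twin cage, target `(0, -3, -3)` (lower cell). -/
theorem twin_local_case_8 (x : Fin 3 → ℝ) (hn : x 0 ^ 2 + x 1 ^ 2 + x 2 ^ 2 = 2)
    (hcap : 3 ≤ x 0 * ((0 : ℤ) : ℝ) + x 1 * ((-3 : ℤ) : ℝ) + x 2 * ((-3 : ℤ) : ℝ))
    (h : ∀ τ ∈ ({(3, -3, 0), (-3, 3, 0), (-3, -3, 0), (3, 0, -3), (-3, 0, 3), (-3, 0, -3), (0, 3, -3), (0, -3, 3), (0, -3, -3), (1, 1, 4), (1, 4, 1), (4, 1, 1)} : Finset (ℤ × ℤ × ℤ)), (0 : ℤ) * τ.1 + (-3 : ℤ) * τ.2.1 + (-3 : ℤ) * τ.2.2 = 9 →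
      x 0 * τ.1 + x 1 * τ.2.1 + x 2 * τ.2.2 ≤ 3) :
    3 * x 0 = ((0 : ℤ) : ℝ) ∧ 3 * x 1 = ((-3 : ℤ) : ℝ) ∧ 3 * x 2 = ((-3 : ℤ) : ℝ) := by
  have g0 := h (-3, -3, 0) (by decide) (by norm_num)
  have g1 := h (-3, 0, -3) (by decide) (by norm_num)
  have g2 := h (3, -3, 0) (by decide) (by norm_num)
  have g3 := h (3, 0, -3) (by decide) (by norm_num)
  norm_num at g0 g1 g2 g3 hcap
  obtain ⟨e1, e2, e3⟩ := twin_local_lower (x 1) (x 2) (x 0) (by nlinarith [hn]) (by linarith [hcap]) (by linarith [g0]) (by linarith [g1]) (by linarith [g2]) (by linarith [g3])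
  push_cast
  exact ⟨by linarith, by linarith, by linarith⟩

/-- Local twin cage, target `(1, 1, 4)` (mirror cell). -/
theorem twin_local_case_9 (x : Fin 3 → ℝ) (hn : x 0 ^ 2 + x 1 ^ 2 + x 2 ^ 2 = 2)
    (hcap : 3 ≤ x 0 * ((1 : ℤ) : ℝ) + x 1 * ((1 : ℤ) : ℝ) + x 2 * ((4 : ℤ) : ℝ))
    (h : ∀ τ ∈ ({(3, -3, 0), (-3, 3, 0), (-3, -3, 0), (3, 0, -3), (-3, 0, 3), (-3, 0, -3), (0, 3, -3), (0, -3, 3), (0, -3, -3), (1, 1, 4), (1, 4, 1), (4, 1, 1)} : Finset (ℤ × ℤ × ℤ)), (1 : ℤ) * τ.1 + (1 : ℤ) * τ.2.1 + (4 : ℤ) * τ.2.2 = 9 →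
      x 0 * τ.1 + x 1 * τ.2.1 + x 2 * τ.2.2 ≤ 3) :
    3 * x 0 = ((1 : ℤ) : ℝ) ∧ 3 * x 1 = ((1 : ℤ) : ℝ) ∧ 3 * x 2 = ((4 : ℤ) : ℝ) := by
  have g0 := h (0, -3, 3) (by decide) (by norm_num)
  have g1 := h (-3, 0, 3) (by decide) (by norm_num)
  have g2 := h (1, 4, 1) (by decide) (by norm_num)
  have g3 := h (4, 1, 1) (by decide) (by norm_num)
  norm_num at g0 g1 g2 g3 hcap
  obtain ⟨e1, e2, e3⟩ := twin_local_mirror (x 0) (x 1) (x 2) (by nlinarith [hn]) (by linarith [hcap]) (by linarith [g0]) (by linarith [g1]) (by linarith [g2]) (by linarith [g3])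
  push_cast
  exact ⟨by linarith, by linarith, by linarith⟩

/-- Local twin cage, target `(1, 4, 1)` (mirror cell). -/
theorem twin_local_case_10 (x : Fin 3 → ℝ) (hn : x 0 ^ 2 + x 1 ^ 2 + x 2 ^ 2 = 2)
    (hcap : 3 ≤ x 0 * ((1 : ℤ) : ℝ) + x 1 * ((4 : ℤ) : ℝ) + x 2 * ((1 : ℤ) : ℝ))
    (h : ∀ τ ∈ ({(3, -3, 0), (-3, 3, 0), (-3, -3, 0), (3, 0, -3), (-3, 0, 3), (-3, 0, -3), (0, 3, -3), (0, -3, 3), (0, -3, -3), (1, 1, 4), (1, 4, 1), (4, 1, 1)} : Finset (ℤ × ℤ × ℤ)), (1 : ℤ) * τ.1 + (4 : ℤ) * τ.2.1 + (1 : ℤ) * τ.2.2 = 9 →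
      x 0 * τ.1 + x 1 * τ.2.1 + x 2 * τ.2.2 ≤ 3) :
    3 * x 0 = ((1 : ℤ) : ℝ) ∧ 3 * x 1 = ((4 : ℤ) : ℝ) ∧ 3 * x 2 = ((1 : ℤ) : ℝ) := by
  have g0 := h (0, 3, -3) (by decide) (by norm_num)
  have g1 := h (-3, 3, 0) (by decide) (by norm_num)
  have g2 := h (1, 1, 4) (by decide) (by norm_num)
  have g3 := h (4, 1, 1) (by decide) (by norm_num)
  norm_num at g0 g1 g2 g3 hcap
  obtain ⟨e1, e2, e3⟩ := twin_local_mirror (x 0) (x 2) (x 1) (by nlinarith [hn]) (by linarith [hcap]) (by linarith [g0]) (by linarith [g1]) (by linarith [g2]) (by linarith [g3])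
  push_cast
  exact ⟨by linarith, by linarith, by linarith⟩

/-- Local twin cage, target `(4, 1, 1)` (mirror cell). -/
theorem twin_local_case_11 (x : Fin 3 → ℝ) (hn : x 0 ^ 2 + x 1 ^ 2 + x 2 ^ 2 = 2)
    (hcap : 3 ≤ x 0 * ((4 : ℤ) : ℝ) + x 1 * ((1 : ℤ) : ℝ) + x 2 * ((1 : ℤ) : ℝ))
    (h : ∀ τ ∈ ({(3, -3, 0), (-3, 3, 0), (-3, -3, 0), (3, 0, -3), (-3, 0, 3), (-3, 0, -3), (0, 3, -3), (0, -3, 3), (0, -3, -3), (1, 1, 4), (1, 4, 1), (4, 1, 1)} : Finset (ℤ × ℤ × ℤ)), (4 : ℤ) * τ.1 + (1 : ℤ) * τ.2.1 + (1 : ℤ) * τ.2.2 = 9 →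
      x 0 * τ.1 + x 1 * τ.2.1 + x 2 * τ.2.2 ≤ 3) :
    3 * x 0 = ((4 : ℤ) : ℝ) ∧ 3 * x 1 = ((1 : ℤ) : ℝ) ∧ 3 * x 2 = ((1 : ℤ) : ℝ) := by
  have g0 := h (3, 0, -3) (by decide) (by norm_num)
  have g1 := h (3, -3, 0) (by decide) (by norm_num)
  have g2 := h (1, 1, 4) (by decide) (by norm_num)
  have g3 := h (1, 4, 1) (by decide) (by norm_num)
  norm_num at g0 g1 g2 g3 hcap
  obtain ⟨e1, e2, e3⟩ := twin_local_mirror (x 1) (x 2) (x 0) (by nlinarith [hn]) (by linarith [hcap]) (by linarith [g0]) (by linarith [g1]) (by linarith [g2]) (by linarith [g3])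
  push_cast
  exact ⟨by linarith, by linarith, by linarith⟩

/-- **Local twin cage core**: for a table entry `τ₀`, `Σ xᵢ² = 2`, `x·τ₀ ≥ 3` and `x·τ ≤ 3` for the entries `τ` with
`τ₀·τ = 9` force `3x = τ₀`. -/
theorem twin_local_core_triple (x : Fin 3 → ℝ) (hn : x 0 ^ 2 + x 1 ^ 2 + x 2 ^ 2 = 2) (a b c : ℤ)
    (habc : (a, b, c) ∈ ({(3, -3, 0), (-3, 3, 0), (-3, -3, 0), (3, 0, -3), (-3, 0, 3), (-3, 0, -3), (0, 3, -3), (0, -3, 3), (0, -3, -3), (1, 1, 4), (1, 4, 1), (4, 1, 1)} : Finset (ℤ × ℤ × ℤ)))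
    (hcap : 3 ≤ x 0 * a + x 1 * b + x 2 * c)
    (h : ∀ τ ∈ ({(3, -3, 0), (-3, 3, 0), (-3, -3, 0), (3, 0, -3), (-3, 0, 3), (-3, 0, -3), (0, 3, -3), (0, -3, 3), (0, -3, -3), (1, 1, 4), (1, 4, 1), (4, 1, 1)} : Finset (ℤ × ℤ × ℤ)), a * τ.1 + b * τ.2.1 + c * τ.2.2 = 9 →
      x 0 * τ.1 + x 1 * τ.2.1 + x 2 * τ.2.2 ≤ 3) :
    3 * x 0 = a ∧ 3 * x 1 = b ∧ 3 * x 2 = c := by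
  simp only [Finset.mem_insert, Finset.mem_singleton, Prod.mk.injEq] at habc
  rcases habc with ⟨rfl, rfl, rfl⟩ | ⟨rfl, rfl, rfl⟩ | ⟨rfl, rfl, rfl⟩ | ⟨rfl, rfl, rfl⟩ | ⟨rfl, rfl, rfl⟩ | ⟨rfl, rfl, rfl⟩ | ⟨rfl, rfl, rfl⟩ | ⟨rfl, rfl, rfl⟩ | ⟨rfl, rfl, rfl⟩ | ⟨rfl, rfl, rfl⟩ | ⟨rfl, rfl, rfl⟩ | ⟨rfl, rfl, rfl⟩
  · exact twin_local_case_0 x hn hcap h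
  · exact twin_local_case_1 x hn hcap h
  · exact twin_local_case_2 x hn hcap h
  · exact twin_local_case_3 x hn hcap h
  · exact twin_local_case_4 x hn hcap h
  · exact twin_local_case_5 x hn hcap h
  · exact twin_local_case_6 x hn hcap h
  · exact twin_local_case_7 x hn hcap h
  · exact twin_local_case_8 x hn hcap h
  · exact twin_local_case_9 x hn hcap h
  · exact twin_local_case_10 x hn hcap h
  · exact twin_local_case_11 x hn hcap h

end Summit.Ventures.Crystal3D.Theorems

end
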